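import Summits.AtomisticToContinuum.Crystallization.Theorems.FluxTubeKeplerFloorGivesLayered
import Summits.AtomisticToContinuum.Crystallization.Theorems.FluxTubeKeplerFluxCellKeplerSingleScale

/-!
# `DeepDeficitRung` — F3 witness file (`specialises`): the CAP family at `θ = ⊤` IS the proved floor

Self-contained restatement of the graded family `CapRung θ` (namespace `….CapLadder.Special`, so that this file
elaborates on its own) and the kernel-checked facts

* `capRung_top : CapRung ⊤` — PROVED from the seed theorem
  `FluxTubeKeplerFloorGivesLayered.FloorGivesLayered_proof` and the landed `FluxTubeKepler.PeriodicGivenLayered_holds`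
  (`capBudget_top_iff`: at cap depth `⊤` the capped currency `∑ᵢ capExcess ⊤ (½𝓔ⁱ − e(P₀))` is literally the net
  excess `E − N·e(P₀)`, by `two_mul_interactionEnergy`);
* `capRung_mono : θ ≤ θ' → CapRung θ → CapRung θ'` — the dial is monotone, so the deciding rung
  `DeepDeficitRung = CapRung (1/4)` gives back the floor member (`capRung_top_of_deepDeficitRung`).

No `sorry`.  BC5 witness = `capRung_top` (the floor member of the family, regime: cap depth `⊤`; the rung's regime
`θ = 1/4` is outside everything the tree proves — nothing in the tree prices over-binding).
-/

noncomputable section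

namespace Summit.AtomisticToContinuum.Crystallization.Cruxes.FluxCellKepler.CapLadder.Special

open Filter Topology
open Literature.MathematicalPhysics.StatisticalMechanics
open Summit.AtomisticToContinuum.Crystallization.Theorems.FluxCellKeplerSingleScale (LayeredGood)

local notation "E3" => EuclideanSpace ℝ (Fin 3)

/-- FLOOR(P₀): `N · e(P₀) ≤ E(x)` for every Lennard-Jones ground state `x` of every size `N`
(verbatim the first hypothesis of `FluxTubeKepler.FloorGivesLayered`). -/
def Floor (P₀ : PeriodicConfiguration 3) : Prop :=
  ∀ (N : ℕ) (x : Fin N → E3), IsGroundState lennardJones x →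
    (N : ℝ) * P₀.energyPerParticle lennardJones ≤ interactionEnergy lennardJones x

/-- The capped site excess: the value `s` itself when `θ = ⊤` (no cap), else `max s (−θ)`
(a deficit deeper than `θ` counts only as `−θ`). -/
def capExcess (θ : WithTop ℝ) (s : ℝ) : ℝ := WithTop.recTopCoe s (fun t : ℝ => max s (-t)) θ

@[simp] theorem capExcess_top (s : ℝ) : capExcess ⊤ s = s := rfl

@[simp] theorem capExcess_coe (t s : ℝ) : capExcess (t : WithTop ℝ) s = max s (-t) := rfl

/-- The site excess of site `i` over the reference energy per particle of `P₀`: `½𝓔ⁱ(x) − e(P₀)`. -/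
def siteExcess (P₀ : PeriodicConfiguration 3) {N : ℕ} (x : Fin N → E3) (i : Fin N) : ℝ :=
  siteEnergy lennardJones x i / 2 - P₀.energyPerParticle lennardJones

/-- CAPPED BUDGET with cap depth `θ`: for every radius `R > 0` and tolerance `η > 0` some `c > 0` prices the
`(R,η)`-non-layered sites of every Lennard-Jones ground state against the CAPPED excess
`∑ᵢ capExcess θ (½𝓔ⁱ(x) − e(P₀))` (`θ = ⊤`: the floor's budget, `LayeredGood` = the crux's defect predicate,
quantifier order `∀ R η ∃ c` of the crux kept). -/
def CapBudget (θ : WithTop ℝ) (P₀ : PeriodicConfiguration 3) : Prop :=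
  ∀ R η : ℝ, 0 < R → 0 < η → ∃ c : ℝ, 0 < c ∧
    ∀ (N : ℕ) (x : Fin N → E3), IsGroundState lennardJones x →
      c * (Nat.card {i : Fin N // ¬ LayeredGood R η x i} : ℝ) ≤ ∑ i, capExcess θ (siteExcess P₀ x i)

/-- Periodic windows at every scale along the sequence `x` (ONE periodic `P`, translations only) —
verbatim the conclusion of `FluxTubeKepler.PeriodicWindows` / `FluxTubeKepler.PeriodicGivenLayered`. -/
def HasPeriodicWindows (x : (N : ℕ) → (Fin N → E3)) : Prop :=
  ∃ P : PeriodicConfiguration 3, ∀ R ε : ℝ, 0 < ε → ∃ᶠ N in atTop, ∃ t : E3,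
    (∀ q ∈ P.points, ‖q‖ ≤ R → ∃ i : Fin N, dist (x N i + t) q ≤ ε) ∧
    (∀ i : Fin N, ‖x N i + t‖ ≤ R → ∃ q ∈ P.points, dist (x N i + t) q ≤ ε)

/-- **The graded family.** `CapRung θ`: FLOOR and the capped budget with cap depth `θ` force periodic windows
along every Lennard-Jones ground-state sequence. -/
def CapRung (θ : WithTop ℝ) : Prop :=
  ∀ P₀ : PeriodicConfiguration 3, Floor P₀ → CapBudget θ P₀ →
    ∀ x : (N : ℕ) → (Fin N → E3), (∀ N, IsGroundState lennardJones (x N)) → HasPeriodicWindows x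

/-- **Deciding rung** (cap depth `1/4`): a certificate that never pays for a site over-bound by more than
`1/4` below the bulk value still forces crystallization of the ground states. -/
def DeepDeficitRung : Prop := CapRung ((1 / 4 : ℝ) : WithTop ℝ)

/-- The far member of the ladder (cap depth `0`, surplus-only currency), recorded for `LADDER.md`. -/
def DeficitBlindRung : Prop := CapRung ((0 : ℝ) : WithTop ℝ)

/-! ## F3 — the family specialises to the proved floor -/

/-- The net currency: `∑ᵢ (½𝓔ⁱ(x) − e(P₀)) = E(x) − N·e(P₀)` (double counting `2E = ∑ᵢ 𝓔ⁱ`). -/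
theorem sum_siteExcess (P₀ : PeriodicConfiguration 3) {N : ℕ} (x : Fin N → E3) :
    ∑ i, siteExcess P₀ x i =
      interactionEnergy lennardJones x - (N : ℝ) * P₀.energyPerParticle lennardJones := by
  have h := two_mul_interactionEnergy lennardJones x
  simp only [siteExcess, Finset.sum_sub_distrib, Finset.sum_const, Finset.card_univ, Fintype.card_fin,
    nsmul_eq_mul, ← Finset.sum_div, ← h]
  ring

/-- At cap depth `⊤` the capped budget IS the floor's budget. -/
theorem capBudget_top_iff (P₀ : PeriodicConfiguration 3) :
    CapBudget ⊤ P₀ ↔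
      ∀ R η : ℝ, 0 < R → 0 < η → ∃ c : ℝ, 0 < c ∧
        ∀ (N : ℕ) (x : Fin N → E3), IsGroundState lennardJones x →
          c * (Nat.card {i : Fin N // ¬ LayeredGood R η x i} : ℝ) ≤
            interactionEnergy lennardJones x - (N : ℝ) * P₀.energyPerParticle lennardJones := by
  simp only [CapBudget, capExcess_top, sum_siteExcess]

/-- `CapRung ⊤` is the floor: the seed theorem followed by the proved `PeriodicGivenLayered`. -/
theorem capRung_top : CapRung ⊤ := fun P₀ hF hB x hx =>
  Theses.FluxTubeKepler.PeriodicGivenLayered_holds x hx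
    (Theorems.FluxTubeKeplerFloorGivesLayered.FloorGivesLayered_proof P₀ hF
      ((capBudget_top_iff P₀).1 hB) x hx)

/-! ## Dial monotonicity (harder-to-easier = increasing cap depth) -/

/-- The capped excess is antitone in the cap depth. -/
theorem capExcess_anti {θ θ' : WithTop ℝ} (h : θ ≤ θ') (s : ℝ) : capExcess θ' s ≤ capExcess θ s := by
  induction θ' using WithTop.recTopCoe with
  | top =>
    induction θ using WithTop.recTopCoe with
    | top => exact le_rfl
    | coe t => simp only [capExcess_top, capExcess_coe]; exact le_max_left s (-t)
  | coe t' =>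
    induction θ using WithTop.recTopCoe with
    | top => exact absurd h (by simp)
    | coe t =>
      have htt : t ≤ t' := by exact_mod_cast h
      simp only [capExcess_coe]
      exact max_le_max le_rfl (neg_le_neg htt)

/-- A capped budget with a deeper cap (larger `θ`) is a stronger hypothesis. -/
theorem capBudget_anti {θ θ' : WithTop ℝ} (h : θ ≤ θ') {P₀ : PeriodicConfiguration 3} :
    CapBudget θ' P₀ → CapBudget θ P₀ := by
  intro hB R η hR hη
  obtain ⟨c, hc, hcN⟩ := hB R η hR hη
  exact ⟨c, hc, fun N x hx => (hcN N x hx).trans (Finset.sum_le_sum fun i _ => capExcess_anti h _)⟩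

/-- `CapRung` is monotone in the cap depth: a smaller `θ` is the stronger rung. -/
theorem capRung_mono {θ θ' : WithTop ℝ} (h : θ ≤ θ') : CapRung θ → CapRung θ' :=
  fun H P₀ hF hB x hx => H P₀ hF (capBudget_anti h hB) x hx

/-- The deciding rung gives back the floor member (informational `specialises`). -/
theorem capRung_top_of_deepDeficitRung (h : DeepDeficitRung) : CapRung ⊤ := capRung_mono le_top h

/-- Lattice position: the far member implies the deciding rung. -/
theorem deepDeficitRung_of_deficitBlindRung (h : DeficitBlindRung) : DeepDeficitRung :=
  capRung_mono (by exact_mod_cast (by norm_num : (0 : ℝ) ≤ 1 / 4)) h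


/-- F3, literally: the family at the floor's parameter value. -/
example : CapRung ⊤ := capRung_top

/-- F3 for the deciding rung: it specialises to (indeed implies) the floor member. -/
example (h : DeepDeficitRung) : CapRung ⊤ := capRung_top_of_deepDeficitRung h

end Summit.AtomisticToContinuum.Crystallization.Cruxes.FluxCellKepler.CapLadder.Special

end
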